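import Summits.Ventures.CertifiedArithmetic.LowPrec.EmbeddingDecision
import Summits.Ventures.CertifiedArithmetic.LowPrec.RoundToOddSaturation
import Summits.Ventures.CertifiedArithmetic.LowPrec.DirectedMirror

/-!
# Directed double rounding is innocuous exactly when the narrow format embeds (THEOREM D-dir)

HONEST FRAMING (venture CertifiedArithmetic / cell `pub-lowprec`): certified error envelopes and
provably optimal rounding/accumulation schemes for low-precision formats under stated cost models;
every table by two implementations; no hardware or vendor claims.

THEOREM D-dir (every pair of `Format` records `φ` (narrow) and `ψ` (wide); the cell's SATURATING
signed directed roundings `roundDown` / `roundUp` / `roundTowardZero` of `Directed.lean`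
[cite: IEEE7542019, §4.3.2]). For each directed attribute `R ∈ {RD, RU, RZ}`,

  `(∀ x : ℚ, R_φ(R_ψ(x)) = R_φ(x))  ↔  Embeds φ ψ`  (every value of `φ` is a value of `ψ`):

`roundDown_roundDown_iff_embeds`, `roundUp_roundUp_iff_embeds`,
`roundTowardZero_roundTowardZero_iff_embeds` (equalities of VALUES in `ℚ`; the sign of a zero
datum is not a value). Consequently, for EVERY exact operation `op` (sum, product, quotient,
fused multiply-add, square root, dot product, …) and all operands, rounding `op` with a directed
attribute first into an embedding-wider format and then into the narrow one with the SAME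
attribute returns the correctly (directedly) rounded narrow result, saturation included; and
conversely a single slip anywhere on `ℚ` refutes the embedding. On the cell's 13 records the
condition is the decidable `embedsTest` (`roundDown_roundDown_iff_test`; 67 of the 169 ordered
pairs, listed in `EmbeddingDecision.embedPairs`: `roundDown_roundDown_named_iff`).

PROOF. (⇐) In range it is the sandwich `RD_φ(x) ≤ RD_ψ(x) ≤ x` (`RD_φ(x)` is a value of `ψ`
below `x`, `RD_ψ(x)` the largest such), so the largest value of `φ` below `x` is also the largest
below `RD_ψ(x)`; beyond the range both sides saturate to `±maxRat φ`, values of `ψ`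
(`maxRat_le_of_embeds`, §1). `RU` is the mirror image; `RZ` is `RD` on `x ≥ 0`, `RU` on `x < 0`,
and the wide result keeps the side of `0` (§1). (⇒) At a value `a ≥ 0` of `φ`, `v = RD_ψ(a)`
has `0 ≤ v ≤ a`, and the hypothesis gives `RD_φ(v) = RD_φ(a) = a ≤ v`, so `v = a` is a value of
`ψ`; negative values by the sign symmetry of both value sets (`embeds_of_nonneg`).

MIXED ATTRIBUTES ARE NOT COVERED (§5, kernel instances): rounding to NEAREST in the wide format
and then converting with a directed attribute is not the directed operation even under the
embedding — `RD_E4M3(RN_binary16(2⁻⁹ − 2⁻²²)) = 2⁻⁹ ≠ 0 = RD_E4M3(2⁻⁹ − 2⁻²²)` — so a directed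
(or stochastic, which is assembled from `RD`/`RU`) FP8 conversion of a round-to-nearest FP16/FP32
result carries the nearest-rounding error of the wide step; compare THEOREM D-dr / D-fma
(`DoubleRoundingMatrix.lean`, `DoubleRoundingFMA.lean`) for nearest-then-nearest.

PLACEMENT. That double rounding is harmless for directed roundings when the intermediate format
contains the target format is classical, and is the stated design basis of binary32/binary64-hosted
low-precision simulators ("always true for directed rounding" [cite: FasiMikaitis2023, §5]); the
rounding attributes are those of [cite: IEEE7542019, §4.3.2]. What this file adds is the
machine-checked statement over arbitrary format records with the cell's saturating semantics at
`±maxRat`, the converse (innocuous on all of `ℚ` forces the embedding), and the mixed-attribute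
counter-instances. Implementation A (Python, two directed-rounding implementations; exhaustive
one-point-per-cell verification for wide formats of at most 2¹⁶ values; witnesses for the 102
non-embedded pairs and for the mixed attributes): cell files `DOUBLE-ROUNDING-DIRECTED.md`,
`certs/enum/DOUBLE-ROUNDING-DIRECTED.json`, script `code/enum/directed_double_decision.py`.
-/


namespace Summit.Ventures.CertifiedArithmetic

open Literature.ComputerArithmetic.FloatingPoint
open Literature.ComputerArithmetic.FloatingPoint.Format
open Literature.ComputerArithmetic.FloatingPoint.MiniFloat

variable {φ ψ : Format}

/-! ## §1 Values of the directed roundings: fixed points, the side of zero, saturation -/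

/-- Round-down fixes every value of the format. [folklore] -/
theorem toRat_roundDown_value (y : MiniFloat φ) : (roundDown φ y.toRat).toRat = y.toRat :=
  le_antisymm (toRat_roundDown_le y.abs_toRat_le_maxRat)
    (toRat_le_roundDown y.abs_toRat_le_maxRat y le_rfl)

/-- Round-up fixes every value of the format. [folklore] -/
theorem toRat_roundUp_value (y : MiniFloat φ) : (roundUp φ y.toRat).toRat = y.toRat :=
  le_antisymm (roundUp_le_toRat y.abs_toRat_le_maxRat y le_rfl)
    (le_toRat_roundUp y.abs_toRat_le_maxRat)

/-- For `x ≥ 0`, with no range hypothesis: `0 ≤ RD(x) ≤ x` (beyond the top, `RD` saturates to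
`maxRat ≤ x`). [cite: IEEE7542019, §4.3.2] -/
theorem toRat_roundDown_nonneg_le {x : ℚ} (hx : 0 ≤ x) :
    0 ≤ (roundDown φ x).toRat ∧ (roundDown φ x).toRat ≤ x := by
  have hq := φ.quantum_pos
  rw [toRat_roundDown, if_neg (not_lt.mpr hx)]
  refine ⟨mul_nonneg (Nat.cast_nonneg _) hq.le, ?_⟩
  have h1 := Format.rdGrid_le (φ := φ) (div_nonneg (abs_nonneg x) hq.le)
  rw [abs_of_nonneg hx] at h1 ⊢
  exact (le_div_iff₀ hq).mp h1

/-- For `x ≤ 0`, with no range hypothesis: `x ≤ RU(x) ≤ 0`. [cite: IEEE7542019, §4.3.2] -/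
theorem toRat_roundUp_le_nonpos {x : ℚ} (hx : x ≤ 0) :
    x ≤ (roundUp φ x).toRat ∧ (roundUp φ x).toRat ≤ 0 := by
  rcases hx.eq_or_lt with rfl | hx'
  · rw [toRat_roundUp_zero]; exact ⟨le_rfl, le_rfl⟩
  · have hq := φ.quantum_pos
    rw [toRat_roundUp, if_pos hx']
    have h1 := Format.rdGrid_le (φ := φ) (div_nonneg (abs_nonneg x) hq.le)
    rw [abs_of_neg hx'] at h1 ⊢
    have h2 := (le_div_iff₀ hq).mp h1
    have h3 : (0 : ℚ) ≤ (φ.rdGrid (-x / φ.quantum) : ℚ) * φ.quantum :=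
      mul_nonneg (Nat.cast_nonneg _) hq.le
    constructor <;> linarith

/-- SATURATION of round-up at and above the top: `RU(s) = maxRat` for `s ≥ maxRat` (at
`s = maxRat` because `maxRat` is a value). [cite: IEEE7542019, §4.3.2] -/
theorem toRat_roundUp_eq_maxRat {s : ℚ} (h : φ.maxRat ≤ s) :
    (roundUp φ s).toRat = φ.maxRat := by
  rcases h.eq_or_lt with h | h
  · rw [← h, ← toRat_ofScaled_maxScaled φ, toRat_roundUp_value]
  · exact toRat_roundUp_of_maxRat_lt h

/-- SATURATION of round-down at and below the bottom: `RD(s) = -maxRat` for `s ≤ -maxRat`.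
[cite: IEEE7542019, §4.3.2] -/
theorem toRat_roundDown_eq_neg_maxRat {s : ℚ} (h : s ≤ -φ.maxRat) :
    (roundDown φ s).toRat = -φ.maxRat := by
  have h0 := maxRat_nonneg φ
  by_cases hs : s < 0
  · have hq := φ.quantum_pos
    have hr : (φ.maxScaled : ℚ) ≤ |s| / φ.quantum := by
      rw [abs_of_neg hs, le_div_iff₀ hq]; change φ.maxRat ≤ -s; linarith
    rw [toRat_roundDown, if_pos hs]
    rcases hr.eq_or_lt with hr | hr
    · rw [← hr, Format.ruGrid_eq_self_of_representable (MiniFloat.representable_maxScaled φ),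
        neg_mul]; rfl
    · rw [Format.ruGrid_eq_maxScaled_of_lt hr, neg_mul]; rfl
  · have hs0 := not_lt.mp hs
    have hs' : φ.maxRat ≤ s := by linarith
    rw [toRat_roundDown_of_maxRat_le hs']; linarith

/-- SATURATION of round-up at and below the bottom: `RU(s) = -maxRat` for `s ≤ -maxRat`.
[cite: IEEE7542019, §4.3.2] -/
theorem toRat_roundUp_eq_neg_maxRat {s : ℚ} (h : s ≤ -φ.maxRat) :
    (roundUp φ s).toRat = -φ.maxRat := by
  have h0 := maxRat_nonneg φ
  by_cases hs : s < 0
  · have hq := φ.quantum_pos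
    have hr : (φ.maxScaled : ℚ) ≤ |s| / φ.quantum := by
      rw [abs_of_neg hs, le_div_iff₀ hq]; change φ.maxRat ≤ -s; linarith
    rw [toRat_roundUp, if_pos hs, Format.rdGrid_eq_maxScaled_of_le hr, neg_mul]; rfl
  · have hs0 := not_lt.mp hs
    have hs' : s = 0 := by linarith
    have hm : φ.maxRat = 0 := by linarith
    subst hs'
    rw [toRat_roundUp_zero, hm, neg_zero]

/-! ## §2 THEOREM D-dir, sufficiency: under the embedding directed double rounding is innocuous -/

/-- THEOREM D-dir (⇐), round-down: if `φ` embeds in `ψ` then `RD_φ(RD_ψ(x)) = RD_φ(x)` for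
every rational `x` (values; saturation included). [cite: FasiMikaitis2023, §5] -/
theorem toRat_roundDown_roundDown_of_embeds (hE : Embeds φ ψ) (x : ℚ) :
    (roundDown φ (roundDown ψ x).toRat).toRat = (roundDown φ x).toRat := by
  have hM := maxRat_le_of_embeds hE
  have h0 := maxRat_nonneg φ
  have h0ψ := maxRat_nonneg ψ
  rcases le_or_gt φ.maxRat x with hx | hx
  · rw [toRat_roundDown_of_maxRat_le hx]
    apply toRat_roundDown_of_maxRat_le
    rcases le_or_gt x ψ.maxRat with hx2 | hx2
    · obtain ⟨z, hz⟩ := hE (ofScaled φ false φ.maxScaled le_rfl)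
      rw [toRat_ofScaled_maxScaled] at hz
      have := toRat_le_roundDown (abs_le.mpr ⟨by linarith, hx2⟩) z (by rw [hz]; exact hx)
      rwa [hz] at this
    · rw [toRat_roundDown_of_maxRat_le hx2.le]; exact hM
  rcases lt_or_ge x (-φ.maxRat) with hx' | hx'
  · rw [toRat_roundDown_eq_neg_maxRat hx'.le]
    apply toRat_roundDown_eq_neg_maxRat
    rcases le_or_gt (-ψ.maxRat) x with hx2 | hx2
    · exact le_trans (toRat_roundDown_le (abs_le.mpr ⟨hx2, by linarith⟩)) hx'.le
    · rw [toRat_roundDown_eq_neg_maxRat hx2.le]; linarith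
  · have hax : |x| ≤ φ.maxRat := abs_le.mpr ⟨hx', hx.le⟩
    have haxψ : |x| ≤ ψ.maxRat := le_trans hax hM
    have hwx : (roundDown φ x).toRat ≤ x := toRat_roundDown_le hax
    obtain ⟨z, hz⟩ := hE (roundDown φ x)
    have hwv : (roundDown φ x).toRat ≤ (roundDown ψ x).toRat := by
      rw [← hz]; exact toRat_le_roundDown haxψ z (by rw [hz]; exact hwx)
    have hvx : (roundDown ψ x).toRat ≤ x := toRat_roundDown_le haxψ
    have hwlo : -φ.maxRat ≤ (roundDown φ x).toRat := (abs_le.mp (abs_toRat_le_maxRat _)).1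
    have hav : |(roundDown ψ x).toRat| ≤ φ.maxRat :=
      abs_le.mpr ⟨le_trans hwlo hwv, le_trans hvx hx.le⟩
    exact le_antisymm (toRat_le_roundDown hax _ (le_trans (toRat_roundDown_le hav) hvx))
      (toRat_le_roundDown hav _ hwv)

/-- THEOREM D-dir (⇐), round-up: if `φ` embeds in `ψ` then `RU_φ(RU_ψ(x)) = RU_φ(x)` for
every rational `x`. [cite: FasiMikaitis2023, §5] -/
theorem toRat_roundUp_roundUp_of_embeds (hE : Embeds φ ψ) (x : ℚ) :
    (roundUp φ (roundUp ψ x).toRat).toRat = (roundUp φ x).toRat := by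
  have hM := maxRat_le_of_embeds hE
  have h0 := maxRat_nonneg φ
  have h0ψ := maxRat_nonneg ψ
  rcases le_or_gt φ.maxRat x with hx | hx
  · rw [toRat_roundUp_eq_maxRat hx]
    apply toRat_roundUp_eq_maxRat
    rcases le_or_gt x ψ.maxRat with hx2 | hx2
    · exact le_trans hx (le_toRat_roundUp (abs_le.mpr ⟨by linarith, hx2⟩))
    · rw [toRat_roundUp_eq_maxRat hx2.le]; exact hM
  rcases lt_or_ge x (-φ.maxRat) with hx' | hx'
  · rw [toRat_roundUp_eq_neg_maxRat hx'.le]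
    apply toRat_roundUp_eq_neg_maxRat
    rcases le_or_gt (-ψ.maxRat) x with hx2 | hx2
    · obtain ⟨z, hz⟩ := hE (ofScaled φ false φ.maxScaled le_rfl).flipSign
      rw [toRat_flipSign, toRat_ofScaled_maxScaled] at hz
      have := roundUp_le_toRat (abs_le.mpr ⟨hx2, by linarith⟩) z (by rw [hz]; exact hx'.le)
      rwa [hz] at this
    · rw [toRat_roundUp_eq_neg_maxRat hx2.le]; linarith
  · have hax : |x| ≤ φ.maxRat := abs_le.mpr ⟨hx', hx.le⟩
    have haxψ : |x| ≤ ψ.maxRat := le_trans hax hM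
    have hxu : x ≤ (roundUp φ x).toRat := le_toRat_roundUp hax
    obtain ⟨z, hz⟩ := hE (roundUp φ x)
    have hvu : (roundUp ψ x).toRat ≤ (roundUp φ x).toRat := by
      rw [← hz]; exact roundUp_le_toRat haxψ z (by rw [hz]; exact hxu)
    have hxv : x ≤ (roundUp ψ x).toRat := le_toRat_roundUp haxψ
    have huhi : (roundUp φ x).toRat ≤ φ.maxRat := (abs_le.mp (abs_toRat_le_maxRat _)).2
    have hav : |(roundUp ψ x).toRat| ≤ φ.maxRat :=
      abs_le.mpr ⟨le_trans hx' hxv, le_trans hvu huhi⟩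
    exact le_antisymm (roundUp_le_toRat hav _ hvu)
      (roundUp_le_toRat hax _ (le_trans hxv (le_toRat_roundUp hav)))

/-- `RZ` is `RU` on `x < 0` and `RD` on `x ≥ 0` (values). [cite: IEEE7542019, §4.3.2] -/
theorem toRat_roundTowardZero_cases (x : ℚ) : (roundTowardZero φ x).toRat =
    if x < 0 then (roundUp φ x).toRat else (roundDown φ x).toRat := by
  by_cases hx : x < 0
  · simp only [toRat_roundTowardZero, toRat_roundUp, if_pos hx]
  · simp only [toRat_roundTowardZero, toRat_roundDown, if_neg hx]

/-- THEOREM D-dir (⇐), round-toward-zero: if `φ` embeds in `ψ` then `RZ_φ(RZ_ψ(x)) = RZ_φ(x)`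
for every rational `x` (the wide result stays on the side of `0` of `x`, or is a zero).
[cite: FasiMikaitis2023, §5] -/
theorem toRat_roundTowardZero_roundTowardZero_of_embeds (hE : Embeds φ ψ) (x : ℚ) :
    (roundTowardZero φ (roundTowardZero ψ x).toRat).toRat = (roundTowardZero φ x).toRat := by
  by_cases hx : x < 0
  · have hv := toRat_roundUp_le_nonpos (φ := ψ) hx.le
    rw [toRat_roundTowardZero_cases (φ := ψ) x, if_pos hx,
      toRat_roundTowardZero_cases (φ := φ) x, if_pos hx]
    rcases hv.2.eq_or_lt with hv0 | hvneg
    · rw [hv0, toRat_roundTowardZero_cases (φ := φ) 0, if_neg (lt_irrefl (0 : ℚ)),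
        toRat_roundDown_zero, ← toRat_roundUp_roundUp_of_embeds hE x, hv0, toRat_roundUp_zero]
    · rw [toRat_roundTowardZero_cases (φ := φ) (roundUp ψ x).toRat, if_pos hvneg,
        toRat_roundUp_roundUp_of_embeds hE]
  · have hx' := not_lt.mp hx
    have hv := toRat_roundDown_nonneg_le (φ := ψ) hx'
    rw [toRat_roundTowardZero_cases (φ := ψ) x, if_neg hx,
      toRat_roundTowardZero_cases (φ := φ) (roundDown ψ x).toRat, if_neg (not_lt.mpr hv.1),
      toRat_roundTowardZero_cases (φ := φ) x, if_neg hx, toRat_roundDown_roundDown_of_embeds hE]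

/-! ## §3 THEOREM D-dir, necessity: one innocuous directed double rounding forces the embedding -/

/-- At a nonnegative value `a` of `φ`: if `RD_φ(RD_ψ(a)) = RD_φ(a)` then `a` is a value of `ψ`
(`0 ≤ RD_ψ(a) ≤ a` and `RD_φ` of it is `a`). -/
theorem exists_toRat_eq_of_roundDown (a : MiniFloat φ) (ha : 0 ≤ a.toRat)
    (h : (roundDown φ (roundDown ψ a.toRat).toRat).toRat = (roundDown φ a.toRat).toRat) :
    ∃ z : MiniFloat ψ, z.toRat = a.toRat := by
  have hv := toRat_roundDown_nonneg_le (φ := ψ) ha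
  have hav : |(roundDown ψ a.toRat).toRat| ≤ φ.maxRat :=
    abs_le.mpr ⟨by linarith [maxRat_nonneg φ, hv.1],
      le_trans hv.2 (abs_le.mp a.abs_toRat_le_maxRat).2⟩
  rw [toRat_roundDown_value] at h
  have h1 := toRat_roundDown_le hav
  rw [h] at h1
  exact ⟨roundDown ψ a.toRat, le_antisymm hv.2 h1⟩

/-- At a nonpositive value `a` of `φ`: if `RU_φ(RU_ψ(a)) = RU_φ(a)` then `a` is a value of
`ψ`. -/
theorem exists_toRat_eq_of_roundUp (a : MiniFloat φ) (ha : a.toRat ≤ 0)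
    (h : (roundUp φ (roundUp ψ a.toRat).toRat).toRat = (roundUp φ a.toRat).toRat) :
    ∃ z : MiniFloat ψ, z.toRat = a.toRat := by
  have hv := toRat_roundUp_le_nonpos (φ := ψ) ha
  have hav : |(roundUp ψ a.toRat).toRat| ≤ φ.maxRat :=
    abs_le.mpr ⟨le_trans (abs_le.mp a.abs_toRat_le_maxRat).1 hv.1,
      by linarith [maxRat_nonneg φ, hv.2]⟩
  rw [toRat_roundUp_value] at h
  have h1 := le_toRat_roundUp hav
  rw [h] at h1
  exact ⟨roundUp ψ a.toRat, le_antisymm h1 hv.1⟩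

/-- Both value sets are symmetric under negation, so `φ` embeds in `ψ` as soon as its nonnegative
values do. [folklore] -/
theorem embeds_of_nonneg
    (H : ∀ a : MiniFloat φ, 0 ≤ a.toRat → ∃ z : MiniFloat ψ, z.toRat = a.toRat) :
    Embeds φ ψ := by
  intro a
  rcases le_or_gt 0 a.toRat with ha | ha
  · exact H a ha
  · obtain ⟨z, hz⟩ := H a.flipSign (by rw [toRat_flipSign]; linarith)
    exact ⟨z.flipSign, by rw [toRat_flipSign, hz, toRat_flipSign, neg_neg]⟩

/-- … and as soon as its nonpositive values do. [folklore] -/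
theorem embeds_of_nonpos
    (H : ∀ a : MiniFloat φ, a.toRat ≤ 0 → ∃ z : MiniFloat ψ, z.toRat = a.toRat) :
    Embeds φ ψ := by
  intro a
  rcases le_or_gt a.toRat 0 with ha | ha
  · exact H a ha
  · obtain ⟨z, hz⟩ := H a.flipSign (by rw [toRat_flipSign]; linarith)
    exact ⟨z.flipSign, by rw [toRat_flipSign, hz, toRat_flipSign, neg_neg]⟩

/-- THEOREM D-dir (⇒), round-down: if `RD_φ ∘ RD_ψ = RD_φ` on `ℚ` (values), `φ` embeds in `ψ`. -/
theorem embeds_of_roundDown_roundDown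
    (h : ∀ x : ℚ, (roundDown φ (roundDown ψ x).toRat).toRat = (roundDown φ x).toRat) :
    Embeds φ ψ :=
  embeds_of_nonneg fun a ha => exists_toRat_eq_of_roundDown a ha (h a.toRat)

/-- THEOREM D-dir (⇒), round-up: if `RU_φ ∘ RU_ψ = RU_φ` on `ℚ` (values), `φ` embeds in `ψ`. -/
theorem embeds_of_roundUp_roundUp
    (h : ∀ x : ℚ, (roundUp φ (roundUp ψ x).toRat).toRat = (roundUp φ x).toRat) :
    Embeds φ ψ :=
  embeds_of_nonpos fun a ha => exists_toRat_eq_of_roundUp a ha (h a.toRat)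

/-- THEOREM D-dir (⇒), round-toward-zero: if `RZ_φ ∘ RZ_ψ = RZ_φ` on `ℚ` (values) then `φ`
embeds in `ψ` (on `x ≥ 0` all three roundings involved are round-downs). -/
theorem embeds_of_roundTowardZero_roundTowardZero
    (h : ∀ x : ℚ, (roundTowardZero φ (roundTowardZero ψ x).toRat).toRat =
      (roundTowardZero φ x).toRat) : Embeds φ ψ :=
  embeds_of_nonneg fun a ha => by
    have h1 := h a.toRat
    have hv := toRat_roundDown_nonneg_le (φ := ψ) ha
    rw [toRat_roundTowardZero_cases (φ := ψ) a.toRat, if_neg (not_lt.mpr ha),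
      toRat_roundTowardZero_cases (φ := φ) (roundDown ψ a.toRat).toRat, if_neg (not_lt.mpr hv.1),
      toRat_roundTowardZero_cases (φ := φ) a.toRat, if_neg (not_lt.mpr ha)] at h1
    exact exists_toRat_eq_of_roundDown a ha h1

/-! ## §4 THEOREM D-dir: the characterisations (every pair of records; the 13 named ones) -/

/-- THEOREM D-dir (RD): directed-down double rounding through `ψ` is innocuous on all of `ℚ` iff
`φ` embeds in `ψ`. [cite: FasiMikaitis2023, §5] -/
theorem roundDown_roundDown_iff_embeds :
    (∀ x : ℚ, (roundDown φ (roundDown ψ x).toRat).toRat = (roundDown φ x).toRat) ↔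
      Embeds φ ψ :=
  ⟨embeds_of_roundDown_roundDown, fun hE x => toRat_roundDown_roundDown_of_embeds hE x⟩

/-- THEOREM D-dir (RU): directed-up double rounding through `ψ` is innocuous on all of `ℚ` iff
`φ` embeds in `ψ`. [cite: FasiMikaitis2023, §5] -/
theorem roundUp_roundUp_iff_embeds :
    (∀ x : ℚ, (roundUp φ (roundUp ψ x).toRat).toRat = (roundUp φ x).toRat) ↔
      Embeds φ ψ :=
  ⟨embeds_of_roundUp_roundUp, fun hE x => toRat_roundUp_roundUp_of_embeds hE x⟩

/-- THEOREM D-dir (RZ): toward-zero double rounding through `ψ` is innocuous on all of `ℚ` iff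
`φ` embeds in `ψ`. [cite: FasiMikaitis2023, §5] -/
theorem roundTowardZero_roundTowardZero_iff_embeds :
    (∀ x : ℚ, (roundTowardZero φ (roundTowardZero ψ x).toRat).toRat =
      (roundTowardZero φ x).toRat) ↔ Embeds φ ψ :=
  ⟨embeds_of_roundTowardZero_roundTowardZero,
    fun hE x => toRat_roundTowardZero_roundTowardZero_of_embeds hE x⟩

/-- DECISION (RD; RU and RZ likewise, through the two `iff_embeds` above) for a standard-operand
source record (all 13 named records are): innocuous iff the closed-form `embedsTest` holds. -/
theorem roundDown_roundDown_iff_test (hstd : stdOperand φ = true) :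
    (∀ x : ℚ, (roundDown φ (roundDown ψ x).toRat).toRat = (roundDown φ x).toRat) ↔
      embedsTest φ ψ = true :=
  roundDown_roundDown_iff_embeds.trans (embeds_iff_test hstd)

/-- THE NAMED MATRIX (RD; RU and RZ have the same matrix by the two theorems above): on the 13
records directed double rounding `X via Y` is innocuous iff `(X, Y)` is one of the 67 pairs of
`EmbeddingDecision.embedPairs`. -/
theorem roundDown_roundDown_named_iff {X Y : Format} (hX : X ∈ namedFormats)
    (hY : Y ∈ namedFormats) :
    (∀ x : ℚ, (roundDown X (roundDown Y x).toRat).toRat = (roundDown X x).toRat) ↔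
      (X, Y) ∈ embedPairs :=
  roundDown_roundDown_iff_embeds.trans (embeds_named_iff hX hY)

/-! ## §5 Readings, and the mixed-attribute slips (kernel) -/

/-- READING: toward-zero FP8 (E4M3) conversion of a toward-zero binary16 result is the toward-zero
E4M3 result, for every rational (E4M3 embeds in binary16). -/
example : ∀ x : ℚ, (roundTowardZero E4M3 (roundTowardZero Binary16 x).toRat).toRat =
    (roundTowardZero E4M3 x).toRat :=
  roundTowardZero_roundTowardZero_iff_embeds.mpr (embeds_of_test (by decide))

/-- READING (negative): round-up E2M3 via round-up E5M2 is NOT round-up E2M3 on all of `ℚ`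
(E2M3 has 4 significand bits, E5M2 only 3: no embedding). -/
example : ¬ ∀ x : ℚ, (roundUp E2M3 (roundUp E5M2 x).toRat).toRat = (roundUp E2M3 x).toRat :=
  fun h => not_embeds_of_test (φ := E2M3) (ψ := E5M2) (by decide) (by decide)
    (embeds_of_roundUp_roundUp h)

/-- MIXED ATTRIBUTES SLIP (kernel): nearest in binary16, then round-DOWN to E4M3, at
`x = 2⁻⁹ − 2⁻²²` gives `2⁻⁹`, but `RD_E4M3(x) = 0`. -/
example :
    (roundDown E4M3 (roundNE Binary16 (1 / 2 ^ 9 - 1 / 2 ^ 22 : ℚ)).toRat).toRat = 1 / 2 ^ 9 ∧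
    (roundDown E4M3 (1 / 2 ^ 9 - 1 / 2 ^ 22 : ℚ)).toRat = 0 := by
  constructor <;> decide +kernel

/-- MIXED ATTRIBUTES SLIP (kernel): nearest in binary16, then round-UP to E4M3, at
`x = 2⁻⁹ + 2⁻²²` gives `2⁻⁹`, but `RU_E4M3(x) = 2⁻⁸`. -/
example :
    (roundUp E4M3 (roundNE Binary16 (1 / 2 ^ 9 + 1 / 2 ^ 22 : ℚ)).toRat).toRat = 1 / 2 ^ 9 ∧
    (roundUp E4M3 (1 / 2 ^ 9 + 1 / 2 ^ 22 : ℚ)).toRat = 1 / 2 ^ 8 := by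
  constructor <;> decide +kernel

/-- MIXED ATTRIBUTES SLIP (kernel): nearest in binary32, then toward-ZERO to E5M2, at
`x = 2⁻¹⁶ − 2⁻⁴²` gives `2⁻¹⁶`, but `RZ_E5M2(x) = 0`. -/
example : (roundTowardZero E5M2 (roundNE Binary32 (1 / 2 ^ 16 - 1 / 2 ^ 42 : ℚ)).toRat).toRat =
    1 / 2 ^ 16 ∧ (roundTowardZero E5M2 (1 / 2 ^ 16 - 1 / 2 ^ 42 : ℚ)).toRat = 0 := by
  constructor <;> decide +kernel

end Summit.Ventures.CertifiedArithmetic
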